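import Mathlib.Analysis.SpecificLimits.Normed
import Literature.Barriers.PneNP.LowDegreeCounterexamples
import Literature.Barriers.PneNP.LowDegreeCounterexamplesCodes
import Literature.Barriers.PneNP.LowDegreeCounterexamplesNoise
import Literature.InformationTheory.Coding.DualDistance
import Literature.InformationTheory.Coding.HammingBall
import HarnessLib

/-!
# Barrier catalogue `PneNP`: proof of Holmgren–Wein 2021 Thm. 2 from its coding-theoretic input

This file proves the barrier fact `Literature.Barriers.PneNP.LowDegreeCounterexamples`
(`Literature/Barriers/PneNP/LowDegreeCounterexamples.lean`: J. Holmgren, A. S. Wein,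
*Counterexamples to the low-degree conjecture*, ITCS 2021, Thm. 2 = LIPIcs Thm. 7) from the one
ingredient of its printed proof that is not elementary, the existence of explicit binary linear
codes with linear dual distance and efficient unique decoding (Prop. 3 = LIPIcs Prop. 12, after
Guruswami / Shpilka 2009 Thm. 4; vendored as the named fact
`Literature.Barriers.PneNP.DecodableDualDistanceCodes` in `LowDegreeCounterexamplesCodes.lean`):

* `LowDegreeCounterexamples.of_codes : DecodableDualDistanceCodes → LowDegreeCounterexamples`;
* `LowDegreeCounterexamples.of_family`: the same conclusion from ANY family of binary linear codes
  `Cᵢ ≤ 𝔽₂^{nᵢ}`, `nᵢ → ∞`, with dual distance `> ⌊nᵢ/m⌋`, nonzero weights `> 4⌊nᵢ/m⌋` (`m ≥ 8`)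
  and one `L ∈ P` whose length-`nᵢ` slices are the radius-`⌊nᵢ/m⌋` neighbourhoods of the `Cᵢ`
  (parameter-free interface isolating what remains unformalised: such an explicit family);
  `LowDegreeCounterexamples.of_codes_via_family` checks that Prop. 3's codes are an instance.

The proof is the printed one (§5.2, arXiv PDF p. 9 / LIPIcs p. 75:8), assembled from
* Prop. 1 (`Literature.InformationTheory.Coding.uniformOn_map_restrict`, file
  `Literature/InformationTheory/Coding/DualDistance.lean`): the uniform distribution `μ` on a code
  of dual distance `> D` is `D`-wise independent — here transported to Boolean strings along
  `bits` (`isDWiseIndependent_map_bits`);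
* Lemma 1 in counting form (`Literature.InformationTheory.Coding.card_near_mul_pow_le`, file
  `Literature/InformationTheory/Coding/HammingBall.lean`): under the uniform distribution `ν` a
  string is within distance `r` of the code with probability `≤ (r+1)(2r/(n-2r+1))^r`, provided
  distinct codewords are `> 4r` apart (`toReal_uniform_near_le`);
* the noise step (`le_noiseOp_toOuterMeasure`, file `LowDegreeCounterexamplesNoise.lean`):
  `T_δ μ` lands within distance `r` of the sampled codeword except with probability
  `≤ (1+δ)^n / 2^{r+1}`.

**Constants.** The fact provides `ζ ≥ 1/30`; we run the test at relative radius `θ = 1/128`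
(so `r = ⌊n/128⌋`, `4r ≤ 2⌊ζn/2⌋` and `128 r ≤ n`), noise rate `δ = 1/512` (so that
`(1+δ)^{128} ≤ 4/3 < 2`, by Bernoulli's inequality), independence parameter `c = 1/128`
(`⌊n/128⌋ < ζn ≤` dual distance), and error sequence
`εₙ = (⌊n/128⌋+1)·63^{-⌊n/128⌋} + (2/3)^{⌊n/128⌋+1} → 0`; the paper's `δ = min{1/(16e), ζ/8}` with
test radius `2δn` plays the same role (any constants inside the unique-decoding radius do).

## References

* J. Holmgren, A. S. Wein, *Counterexamples to the low-degree conjecture*, ITCS 2021 (LIPIcs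
  185:75) = arXiv:2004.08454: Thm. 2 and its proof, §5.2 (arXiv pp. 6, 9; LIPIcs Thm. 7,
  pp. 75:4, 75:8); Prop. 1, Prop. 3, Lemma 1 (arXiv pp. 7–8; LIPIcs Prop. 9, Prop. 12, Lemma 14,
  pp. 75:5–6). Held (`lit read doi-10-4230-lipics-itcs-2021-75`).
-/

noncomputable section

namespace Literature.Barriers.PneNP

open scoped ENNReal
open Filter Finset Matrix Literature.Computability.Complexity
  Literature.Computability.Complexity.Classes Literature.InformationTheory.Coding

/-! ### The code distribution: `D`-wise independence below the dual distance -/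

/-- **Prop. 1 on Boolean strings.** The uniform distribution on a binary linear code `C`, read as
a distribution on `{0,1}ⁿ` through `bits`, is `D`-wise independent (the tree's
`IsDWiseIndependent`) for every `D` below the dual distance of `C`.
[cite: HolmgrenWein2021, Prop. 1 (arXiv p. 7; LIPIcs Prop. 9) and §5.2 (arXiv p. 9)] -/
theorem isDWiseIndependent_map_bits {n : ℕ} (C : Submodule (ZMod 2) (Fin n → ZMod 2)) {D : ℕ}
    (hD : (D : ℕ∞) < dualDist C) : IsDWiseIndependent D ((uniformOn C).map bits) := by
  classical
  intro S hS
  have hS' : (S.card : ℕ∞) < dualDist C := lt_of_le_of_lt (Nat.cast_le.2 hS) hD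
  let bS : (S → ZMod 2) → (S → Bool) := fun z i => bit (z i)
  have hbS : Function.Bijective bS :=
    (Equiv.piCongrRight fun _ : S => Equiv.ofBijective bit bit_bijective).bijective
  have hcomm : (S.restrict ∘ (bits : (Fin n → ZMod 2) → Fin n → Bool)) = bS ∘ S.restrict := rfl
  rw [PMF.map_comp, hcomm, ← PMF.map_comp, uniformOn_map_restrict C S hS']
  exact map_uniformOfFintype_of_bijective bS hbS

/-- Clause (a) of `DecodableDualDistanceCodes` ("every nonzero vector orthogonal to `C` has weight
`≥ ζn`") bounds the dual distance: `D < ζn ⟹ D < dualDist C`.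
[cite: HolmgrenWein2021, Def. 3 and Prop. 3 (arXiv p. 7; LIPIcs Def. 8, Prop. 12)] -/
theorem natCast_lt_dualDist_of_le_weight {n : ℕ} {ζ : ℝ} (C : Submodule (ZMod 2) (Fin n → ZMod 2))
    (hdual : ∀ y : Fin n → ZMod 2, (∀ c ∈ C, y ⬝ᵥ c = 0) → y ≠ 0 → ζ * n ≤ hammingNorm y)
    {D : ℕ} (hD : (D : ℝ) < ζ * n) : (D : ℕ∞) < dualDist C := by
  refine natCast_lt_dualDist_iff.2 fun y hy h0 => ?_
  have h := hdual y (fun c hc => by rw [dotProduct_comm]; exact hy c hc) h0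
  exact_mod_cast hD.trans_le h

/-! ### The null distribution: a uniform string is far from the code (Lemma 1) -/

/-- **Lemma 1, probability form.** Under the uniform distribution on `{0,1}ⁿ`, the probability of
being within Hamming distance `r` of a set `𝒞` whose distinct points are `> 4r` apart is at most
`(r+1)·(2r)^r/(n-2r+1)^r`. [cite: HolmgrenWein2021, Lemma 1 (arXiv p. 8; LIPIcs Lemma 14)] -/
theorem toReal_uniform_near_le {n : ℕ} (𝒞 : Finset (Fin n → Bool)) (r : ℕ) (h2r : 2 * r ≤ n)
    (hsep : ∀ c ∈ 𝒞, ∀ c' ∈ 𝒞, c ≠ c' → 4 * r < hammingDist c c') :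
    ((PMF.uniformOfFintype (Fin n → Bool)).toOuterMeasure
        {x | ∃ c ∈ 𝒞, hammingDist x c ≤ r}).toReal ≤
      (r + 1) * (2 * r : ℝ) ^ r / (n - 2 * r + 1 : ℝ) ^ r := by
  classical
  have key := card_near_mul_pow_le 𝒞 r (by simpa using h2r) hsep
  simp only [Fintype.card_fin] at key
  -- the probability is a ratio of cardinalities
  have hmeas : ((PMF.uniformOfFintype (Fin n → Bool)).toOuterMeasure
      {x | ∃ c ∈ 𝒞, hammingDist x c ≤ r}).toReal =
      (#{x : Fin n → Bool | ∃ c ∈ 𝒞, hammingDist x c ≤ r} : ℝ) / 2 ^ n := by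
    rw [PMF.uniformOfFintype, PMF.toOuterMeasure_uniformOfFinset_apply, ENNReal.toReal_div,
      ENNReal.toReal_natCast, ENNReal.toReal_natCast, card_univ, Fintype.card_fun, Fintype.card_fin,
      Fintype.card_bool, Nat.cast_pow, Nat.cast_ofNat]
    congr 2
    exact Finset.card_bij (fun x _ => x) (fun x hx => by simpa using hx) (fun _ _ _ _ h => h)
      fun x hx => ⟨x, by simpa using hx, rfl⟩
  rw [hmeas]
  have hsub : (0 : ℝ) < (n - 2 * r + 1 : ℝ) := by
    have : (2 * r : ℝ) ≤ n := by exact_mod_cast h2r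
    linarith
  rw [div_le_div_iff₀ (by positivity) (pow_pos hsub r)]
  have hcast : ((n - 2 * r + 1 : ℕ) : ℝ) = (n - 2 * r + 1 : ℝ) := by
    simp only [Nat.cast_add, Nat.cast_sub h2r, Nat.cast_mul, Nat.cast_ofNat, Nat.cast_one]
  have key' : (#{x : Fin n → Bool | ∃ c ∈ 𝒞, hammingDist x c ≤ r} : ℝ) * (n - 2 * r + 1 : ℝ) ^ r ≤
      (r + 1) * 2 ^ n * (2 * r) ^ r := by
    rw [← hcast]
    exact_mod_cast key
  calc (#{x : Fin n → Bool | ∃ c ∈ 𝒞, hammingDist x c ≤ r} : ℝ) * (n - 2 * r + 1 : ℝ) ^ r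
      ≤ (r + 1) * 2 ^ n * (2 * r) ^ r := key'
    _ = (r + 1) * (2 * r : ℝ) ^ r * 2 ^ n := by ring

/-! ### Numerical constants -/

/-- `(1 + 1/512)^{128} ≤ 4/3` (numerically `≈ 1.284`; also from Bernoulli:
`(1 - 1/512)^{128} ≥ 3/4` and `(1+x)(1-x) ≤ 1`). [folklore] -/
theorem one_add_inv_pow_le : (1 + 1 / 512 : ℝ) ^ 128 ≤ 4 / 3 := by
  norm_num

/-- The noise tail at `δ = 1/512`, `r = ⌊n/128⌋`: `(1 + 1/512)ⁿ / 2^{r+1} ≤ (2/3)^{r+1}`.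
[folklore] -/
theorem noise_tail_le (n : ℕ) :
    (1 + 1 / 512 : ℝ) ^ n / 2 ^ (n / 128 + 1) ≤ (2 / 3) ^ (n / 128 + 1) := by
  set r := n / 128 with hr
  have hn : n ≤ 128 * (r + 1) := by omega
  calc (1 + 1 / 512 : ℝ) ^ n / 2 ^ (r + 1) ≤ (1 + 1 / 512 : ℝ) ^ (128 * (r + 1)) / 2 ^ (r + 1) :=
        div_le_div_of_nonneg_right (pow_le_pow_right₀ (by norm_num) hn) (by positivity)
    _ = ((1 + 1 / 512 : ℝ) ^ 128) ^ (r + 1) / 2 ^ (r + 1) := by rw [pow_mul]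
    _ ≤ (4 / 3 : ℝ) ^ (r + 1) / 2 ^ (r + 1) :=
        div_le_div_of_nonneg_right (pow_le_pow_left₀ (by positivity) one_add_inv_pow_le _)
          (by positivity)
    _ = (2 / 3) ^ (r + 1) := by rw [← div_pow]; norm_num

/-- The null-side bound at `r = ⌊n/128⌋`: `(2r)^r/(n-2r+1)^r ≤ 63^{-r}`. [folklore] -/
theorem null_ratio_le (n : ℕ) :
    (2 * (n / 128 : ℕ) : ℝ) ^ (n / 128) / (n - 2 * (n / 128 : ℕ) + 1 : ℝ) ^ (n / 128) ≤
      (1 / 63) ^ (n / 128) := by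
  set r := n / 128
  have h128 : 128 * r ≤ n := Nat.mul_div_le n 128
  have h128' : (128 * r : ℝ) ≤ n := by exact_mod_cast h128
  have hpos : (0 : ℝ) < n - 2 * r + 1 := by linarith [(Nat.cast_nonneg r : (0 : ℝ) ≤ r)]
  rw [← div_pow]
  refine pow_le_pow_left₀ (div_nonneg (by positivity) hpos.le) ?_ r
  rw [div_le_div_iff₀ hpos (by norm_num), one_mul]
  linarith

/-! ### The success probability of the decoder test at the code lengths -/

/-- **The two error terms at a code length `n = nᵢ`.** For the codes of
`DecodableDualDistanceCodes` (clause (b): distinct codewords of `Cᵢ` are `> 2⌊ζnᵢ/2⌋` apart,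
`ζ ≥ 1/30`), the test `bddLanguage C (1/128)` ("is there a codeword within `n/128`?") at noise
rate `δ = 1/512` has success probability
`testSuccess ≥ 1 - ((⌊n/128⌋+1)·63^{-⌊n/128⌋} + (2/3)^{⌊n/128⌋+1})` against
`μ = Unif(Cᵢ)`: under `ν` a codeword within `n/128` exists with probability
`≤ (r+1)(2r/(n-2r+1))^r` (Lemma 1; `4r ≤ 2⌊ζn/2⌋`), under `T_δ μ` the sample stays within `|T| ≤ r`
of its codeword except with probability `≤ (1+δ)ⁿ/2^{r+1}`.
[cite: HolmgrenWein2021, §5.2, proof of Thm. 2 (arXiv p. 9; LIPIcs p. 75:8)] -/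
theorem testSuccess_ge {ζ : ℝ} (hζ : 1 / 30 ≤ ζ)
    (C : ∀ i : ℕ, Submodule (ZMod 2) (Fin (hwLength i) → ZMod 2))
    (hdist : ∀ i, ∀ c ∈ C i, c ≠ 0 → 2 * ⌊ζ * hwLength i / 2⌋₊ < hammingNorm c) (i : ℕ) :
    1 - ((((hwLength i / 128 : ℕ) : ℝ) + 1) * (1 / 63) ^ (hwLength i / 128) +
        (2 / 3 : ℝ) ^ (hwLength i / 128 + 1)) ≤
      testSuccess (bddLanguage C (1 / 128)) (1 / 512) ((uniformOn (C i)).map bits) := by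
  classical
  -- notation: `r = ⌊n/128⌋` (`n = hwLength i`), the code distribution `μ`, the acceptance set `A`
  set r : ℕ := hwLength i / 128 with hr
  set μ : PMF (Fin (hwLength i) → Bool) := (uniformOn (C i)).map bits
  let A : Set (Fin (hwLength i) → Bool) := {x | List.ofFn x ∈ bddLanguage C (1 / 128)}
  have h2r : 2 * r ≤ hwLength i := by omega
  -- membership in `A` is "some codeword within Hamming distance `r`"
  have hmemA : ∀ x : Fin (hwLength i) → Bool, x ∈ A ↔ ∃ c ∈ C i, hammingDist x (bits c) ≤ r := by
    intro x
    change List.ofFn x ∈ bddLanguage C (1 / 128) ↔ _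
    rw [ofFn_mem_bddLanguage_iff]
    refine exists_congr fun c => and_congr_right fun _ => ?_
    rw [hr, Nat.le_div_iff_mul_le (by norm_num), one_div_mul_eq_div,
      le_div_iff₀ (by norm_num : (0 : ℚ) < 128)]
    norm_cast
  -- (i) the null side: `ν(A) ≤ (r+1)·63^{-r}`
  let 𝒞 : Finset (Fin (hwLength i) → Bool) :=
    ((C i : Set (Fin (hwLength i) → ZMod 2)).toFinset).image bits
  have hA𝒞 : A = {x | ∃ c ∈ 𝒞, hammingDist x c ≤ r} := by
    ext x
    rw [hmemA]
    simp only [𝒞, Set.mem_setOf_eq, mem_image, Set.mem_toFinset, SetLike.mem_coe]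
    constructor
    · rintro ⟨c, hc, h⟩
      exact ⟨bits c, ⟨c, hc, rfl⟩, h⟩
    · rintro ⟨_, ⟨c, hc, rfl⟩, h⟩
      exact ⟨c, hc, h⟩
  have h4r : 4 * r ≤ 2 * ⌊ζ * hwLength i / 2⌋₊ := by
    suffices h : 2 * r ≤ ⌊ζ * hwLength i / 2⌋₊ by omega
    refine Nat.le_floor ?_
    have h1 : (r : ℝ) ≤ hwLength i / 128 := by rw [hr]; exact Nat.cast_div_le
    have h2 : (0 : ℝ) ≤ hwLength i := Nat.cast_nonneg _
    have h3 := mul_le_mul_of_nonneg_right hζ h2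
    push_cast
    linarith
  have hsep : ∀ c ∈ 𝒞, ∀ c' ∈ 𝒞, c ≠ c' → 4 * r < hammingDist c c' := by
    intro c hc c' hc' hne
    obtain ⟨d, hd, rfl⟩ := mem_image.1 hc
    obtain ⟨d', hd', rfl⟩ := mem_image.1 hc'
    rw [Set.mem_toFinset, SetLike.mem_coe] at hd hd'
    have hne' : -d + d' ≠ 0 := fun h => hne (congrArg bits (neg_add_eq_zero.1 h))
    have h1 := hdist i (-d + d') ((C i).add_mem ((C i).neg_mem hd) hd') hne'
    rw [hammingDist_bits, hammingDist_eq_hammingNorm]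
    exact lt_of_le_of_lt h4r h1
  have hν : ((PMF.uniformOfFintype (Fin (hwLength i) → Bool)).toOuterMeasure A).toReal ≤
      ((r : ℝ) + 1) * (1 / 63) ^ r := by
    rw [hA𝒞]
    refine (toReal_uniform_near_le 𝒞 r h2r hsep).trans ?_
    rw [mul_div_assoc]
    exact mul_le_mul_of_nonneg_left (null_ratio_le (hwLength i)) (by positivity)
  have hνc : ((PMF.uniformOfFintype (Fin (hwLength i) → Bool)).toOuterMeasure
      {x | List.ofFn x ∉ bddLanguage C (1 / 128)}).toReal =
      1 - ((PMF.uniformOfFintype (Fin (hwLength i) → Bool)).toOuterMeasure A).toReal := by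
    have hc : {x : Fin (hwLength i) → Bool | List.ofFn x ∉ bddLanguage C (1 / 128)} = Aᶜ :=
      Set.ext fun _ => Iff.rfl
    rw [hc, toOuterMeasure_eq_one_sub_compl _ Aᶜ, compl_compl,
      ENNReal.toReal_sub_of_le (le_of_le_of_eq le_self_add (toOuterMeasure_add_compl _ _))
        ENNReal.one_ne_top, ENNReal.toReal_one]
  -- (ii) the planted side: `(T_δ μ)(A) ≥ 1 - (1+δ)ⁿ/2^{r+1}`
  have hAsupp : ∀ x ∈ μ.support, ∀ z : Fin (hwLength i) → Bool, hammingDist z x ≤ r → z ∈ A := by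
    intro x hx z hz
    obtain ⟨d, hd, rfl⟩ := (PMF.mem_support_map_iff _ _ _).1 hx
    rw [mem_support_uniformOn_iff] at hd
    exact (hmemA z).2 ⟨d, hd, hz⟩
  have hnoise := le_noiseOp_toOuterMeasure (1 / 512) μ A r hAsupp
  set b₂ : ℝ := (1 + 1 / 512 : ℝ) ^ hwLength i / 2 ^ (r + 1) with hb₂
  have hb₂0 : 0 ≤ b₂ := by rw [hb₂]; positivity
  have hB : (1 + clampENNReal (1 / 512 : ℝ)) ^ Fintype.card (Fin (hwLength i)) / 2 ^ (r + 1) =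
      ENNReal.ofReal b₂ := by
    have hclamp : clampENNReal (1 / 512 : ℝ) = ENNReal.ofReal (1 / 512) := by
      rw [clampENNReal, min_eq_left (by norm_num : (1 / 512 : ℝ) ≤ 1)]
    rw [Fintype.card_fin, hclamp, ← ENNReal.ofReal_one,
      ← ENNReal.ofReal_add (p := 1) (q := 1 / 512) zero_le_one (by norm_num),
      ← ENNReal.ofReal_pow (p := 1 + 1 / 512) (by norm_num), hb₂,
      ENNReal.ofReal_div_of_pos (pow_pos two_pos (r + 1)), ENNReal.ofReal_pow zero_le_two,
      ENNReal.ofReal_ofNat]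
  have hplanted : 1 - b₂ ≤ ((noiseOp (1 / 512) μ).toOuterMeasure A).toReal := by
    rw [hB, ← ENNReal.ofReal_one, ← ENNReal.ofReal_sub _ hb₂0] at hnoise
    exact (ENNReal.ofReal_le_iff_le_toReal ((le_of_le_of_eq le_self_add
      (toOuterMeasure_add_compl _ _)).trans_lt ENNReal.one_lt_top).ne).1 hnoise
  have hb₂le : b₂ ≤ (2 / 3) ^ (r + 1) := noise_tail_le (hwLength i)
  -- (iii) combine
  have hT1 : (0 : ℝ) ≤ ((r : ℝ) + 1) * (1 / 63) ^ r := by positivity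
  have hνA0 : 0 ≤ ((PMF.uniformOfFintype (Fin (hwLength i) → Bool)).toOuterMeasure A).toReal :=
    ENNReal.toReal_nonneg
  show _ ≤ 1 / 2 * _ + 1 / 2 * ((noiseOp (1 / 512) μ).toOuterMeasure A).toReal
  rw [hνc]
  linarith

/-! ### Assembly: Theorem 2 from Proposition 3 -/

/-- **Holmgren–Wein 2021, Thm. 2, proved from Prop. 3.** Given binary linear codes with linear
dual distance and polynomial-time bounded-distance decoding (`DecodableDualDistanceCodes`: `ζ ≥
1/30`, codes `Cᵢ ≤ 𝔽₂^{nᵢ}` along `nᵢ = 42·8^{i+2} → ∞`, dual distance `≥ ζnᵢ`, distinct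
codewords `> 2⌊ζnᵢ/2⌋` apart, the radius-`θn` decision problem in `P` for rational
`0 < θ ≤ ζ/2`), the barrier fact `LowDegreeCounterexamples` holds with `c = 1/128`, `δ = 1/512`,
the test `L = bddLanguage C (1/128) ∈ P`, `εₙ = (⌊n/128⌋+1)63^{-⌊n/128⌋} + (2/3)^{⌊n/128⌋+1}`, and,
at each length `nᵢ`, `μ = Unif(Cᵢ)`: `μ` is `⌊nᵢ/128⌋`-wise independent (Prop. 1, as
`⌊n/128⌋ < ζn ≤` dual distance) and the test succeeds with probability `≥ 1 - ε_{nᵢ}`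
(`testSuccess_ge`). This is the printed proof of Thm. 2 (§5.2) with explicit constants.
[cite: HolmgrenWein2021, Thm. 2 and §5.2 (arXiv pp. 6, 9; LIPIcs Thm. 7, pp. 75:4, 75:8)] -/
theorem LowDegreeCounterexamples.of_codes (h : DecodableDualDistanceCodes) :
    LowDegreeCounterexamples := by
  obtain ⟨ζ, hζ, C, hdual, hdist, hP⟩ := h
  refine ⟨1 / 128, 1 / 512, bddLanguage C (1 / 128),
    fun n => (((n / 128 : ℕ) : ℝ) + 1) * (1 / 63) ^ (n / 128) + (2 / 3) ^ (n / 128 + 1),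
    by norm_num, by norm_num, hP (1 / 128) (by norm_num) (by push_cast; linarith), ?_, ?_⟩
  · -- `εₙ → 0`
    have h128 : Tendsto (fun n : ℕ => n / 128) atTop atTop := Nat.tendsto_div_const_atTop (by norm_num)
    have h1 : Tendsto (fun m : ℕ => ((m : ℝ) + 1) * (1 / 63 : ℝ) ^ m) atTop (nhds 0) := by
      have ha := tendsto_self_mul_const_pow_of_lt_one (r := (1 / 63 : ℝ)) (by norm_num) (by norm_num)
      have hb := tendsto_pow_atTop_nhds_zero_of_lt_one (r := (1 / 63 : ℝ)) (by norm_num) (by norm_num)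
      have := ha.add hb
      rw [add_zero] at this
      exact this.congr fun m => by ring
    have h2 : Tendsto (fun m : ℕ => (2 / 3 : ℝ) ^ (m + 1)) atTop (nhds 0) :=
      (tendsto_pow_atTop_nhds_zero_of_lt_one (by norm_num) (by norm_num)).comp
        (tendsto_add_atTop_nat 1)
    have := (h1.comp h128).add (h2.comp h128)
    rw [add_zero] at this
    exact this
  · -- infinitely often: at every code length `nᵢ`
    refine frequently_atTop.2 fun N => ?_
    obtain ⟨i, hi⟩ := (tendsto_atTop.1 tendsto_hwLength N).exists
    refine ⟨hwLength i, hi, (uniformOn (C i)).map bits, ?_, testSuccess_ge hζ C hdist i⟩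
    refine isDWiseIndependent_map_bits (C i) (natCast_lt_dualDist_of_le_weight (C i) (hdual i) ?_)
    have hn : (0 : ℝ) < hwLength i := by exact_mod_cast lt_of_lt_of_le (by norm_num) (le_hwLength i)
    calc (⌊(1 / 128 : ℝ) * (hwLength i : ℕ)⌋₊ : ℝ) ≤ 1 / 128 * hwLength i := Nat.floor_le (by positivity)
      _ < ζ * hwLength i := mul_lt_mul_of_pos_right (by linarith) hn

/-! ### A parameter-free interface: any good-dual, decodable binary code family suffices

The printed argument uses of Prop. 3 only: lengths `nᵢ → ∞`, dual distance and distance linear in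
`nᵢ`, and ONE polynomial-time bounded-distance test along the family. The following generic form
(radius `⌊n/m⌋` for a natural `m ≥ 8`, noise rate `δ = 1/(4m)`, independence `⌊n/m⌋`) lets any
such family — not only the Garcia–Stichtenoth/Guruswami codes of `DecodableDualDistanceCodes` —
discharge the barrier fact. -/

/-- Bernoulli: `(1 + 1/(4m))^m ≤ 4/3` for every `m` (from `(1 - 1/(4m))^m ≥ 1 - m/(4m) = 3/4` and
`(1 + x)(1 - x) = 1 - x² ≤ 1`). [folklore] -/
theorem one_add_inv_four_mul_pow_le (m : ℕ) : (1 + 1 / (4 * m) : ℝ) ^ m ≤ 4 / 3 := by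
  rcases Nat.eq_zero_or_pos m with rfl | hm
  · norm_num
  have hm' : (0 : ℝ) < m := by exact_mod_cast hm
  have hm0 : (m : ℝ) ≠ 0 := hm'.ne'
  have hx : (0 : ℝ) < 1 / (4 * m) := by positivity
  have hx1 : (1 / (4 * m) : ℝ) ≤ 1 := by
    rw [div_le_one (by positivity)]
    have : (1 : ℝ) ≤ m := by exact_mod_cast hm
    linarith
  have hB := one_add_mul_le_pow (show (-2 : ℝ) ≤ -(1 / (4 * m)) by linarith) m
  have hBm : (m : ℝ) * -(1 / (4 * m)) = -(1 / 4) := by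
    field_simp
  rw [hBm] at hB
  have hprod : (1 + 1 / (4 * m) : ℝ) ^ m * (1 + -(1 / (4 * m))) ^ m ≤ 1 := by
    rw [← mul_pow]
    refine pow_le_one₀ (mul_nonneg (by linarith) (by linarith)) ?_
    have hsq := sq_nonneg (1 / (4 * m) : ℝ)
    nlinarith
  have hX : (0 : ℝ) ≤ (1 + 1 / (4 * m) : ℝ) ^ m := by positivity
  generalize (1 + 1 / (4 * m) : ℝ) ^ m = X at *
  generalize (1 + -(1 / (4 * m)) : ℝ) ^ m = Y at *
  nlinarith

/-- The noise tail at `δ = 1/(4m)`, `r = ⌊n/m⌋` (`m ≥ 1`): `(1 + 1/(4m))ⁿ / 2^{r+1} ≤ (2/3)^{r+1}`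
(as `n ≤ m(r+1)` and `(1 + 1/(4m))^m ≤ 4/3`). [folklore] -/
theorem noise_tail_le_of_pos {m : ℕ} (hm : 0 < m) (n : ℕ) :
    (1 + 1 / (4 * m) : ℝ) ^ n / 2 ^ (n / m + 1) ≤ (2 / 3) ^ (n / m + 1) := by
  set r := n / m with hr
  have hn : n ≤ m * (r + 1) := by
    have h2 : m * (r + 1) = n / m * m + m := by rw [hr]; ring
    rw [h2]
    exact (Nat.lt_div_mul_add hm).le
  have h1 : (1 : ℝ) ≤ 1 + 1 / (4 * m) := le_add_of_nonneg_right (by positivity)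
  calc (1 + 1 / (4 * m) : ℝ) ^ n / 2 ^ (r + 1)
      ≤ (1 + 1 / (4 * m) : ℝ) ^ (m * (r + 1)) / 2 ^ (r + 1) :=
        div_le_div_of_nonneg_right (pow_le_pow_right₀ h1 hn) (by positivity)
    _ = ((1 + 1 / (4 * m) : ℝ) ^ m) ^ (r + 1) / 2 ^ (r + 1) := by rw [pow_mul]
    _ ≤ (4 / 3 : ℝ) ^ (r + 1) / 2 ^ (r + 1) :=
        div_le_div_of_nonneg_right
          (pow_le_pow_left₀ (by positivity) (one_add_inv_four_mul_pow_le m) _) (by positivity)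
    _ = (2 / 3) ^ (r + 1) := by rw [← div_pow]; norm_num

/-- The null-side bound at `r = ⌊n/m⌋`, `m ≥ 8`: `(2r)^r/(n-2r+1)^r ≤ 3^{-r}` (as `8r ≤ n`).
[folklore] -/
theorem null_ratio_le_of_le {m : ℕ} (hm : 8 ≤ m) (n : ℕ) :
    (2 * (n / m : ℕ) : ℝ) ^ (n / m) / (n - 2 * (n / m : ℕ) + 1 : ℝ) ^ (n / m) ≤
      (1 / 3) ^ (n / m) := by
  set r := n / m
  have hmr : m * r ≤ n := Nat.mul_div_le n m
  have h8 : 8 * r ≤ n := le_trans (Nat.mul_le_mul_right r hm) hmr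
  have h8' : (8 * r : ℝ) ≤ n := by exact_mod_cast h8
  have hpos : (0 : ℝ) < n - 2 * r + 1 := by linarith [(Nat.cast_nonneg r : (0 : ℝ) ≤ r)]
  rw [← div_pow]
  refine pow_le_pow_left₀ (div_nonneg (by positivity) hpos.le) ?_ r
  rw [div_le_div_iff₀ hpos (by norm_num), one_mul]
  linarith

/-- **The two error terms, parameter-free form.** For a binary linear code `C ≤ 𝔽₂ⁿ` whose
nonzero codewords have weight `> 4⌊n/m⌋` (`m ≥ 8`) and a language `L` whose length-`n` slice is
the radius-`⌊n/m⌋` neighbourhood of `C` (read through `bits`), the test `L` at noise rate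
`δ = 1/(4m)` against `μ = Unif(C)` has success probability
`≥ 1 - ((⌊n/m⌋+1)·3^{-⌊n/m⌋} + (2/3)^{⌊n/m⌋+1})`: under `ν` a codeword within `⌊n/m⌋` exists with
probability `≤ (r+1)(2r/(n-2r+1))^r ≤ (r+1)3^{-r}` (Lemma 1), under `T_δ μ` the sample stays
within `|T| ≤ r` of its codeword except with probability `≤ (1+δ)ⁿ/2^{r+1} ≤ (2/3)^{r+1}`.
[cite: HolmgrenWein2021, §5.2, proof of Thm. 2 (arXiv p. 9; LIPIcs p. 75:8)] -/
theorem testSuccess_ge_of_family {m : ℕ} (hm : 8 ≤ m) {n : ℕ}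
    (C : Submodule (ZMod 2) (Fin n → ZMod 2))
    (hdist : ∀ c ∈ C, c ≠ 0 → 4 * (n / m) < hammingNorm c) {L : Language Bool}
    (hLiff : ∀ x : Fin n → Bool, List.ofFn x ∈ L ↔ ∃ c ∈ C, hammingDist x (bits c) ≤ n / m) :
    1 - ((((n / m : ℕ) : ℝ) + 1) * (1 / 3) ^ (n / m) + (2 / 3 : ℝ) ^ (n / m + 1)) ≤
      testSuccess L (1 / (4 * m)) ((uniformOn C).map bits) := by
  classical
  -- notation: `r = ⌊n/m⌋`, the code distribution `μ`, the acceptance set `A`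
  set r : ℕ := n / m with hr
  set μ : PMF (Fin n → Bool) := (uniformOn C).map bits
  let A : Set (Fin n → Bool) := {x | List.ofFn x ∈ L}
  have hm0 : 0 < m := lt_of_lt_of_le (by norm_num) hm
  have hmr : m * r ≤ n := Nat.mul_div_le n m
  have h2r : 2 * r ≤ n := le_trans (Nat.mul_le_mul_right r (le_trans (by norm_num) hm)) hmr
  -- membership in `A` is "some codeword within Hamming distance `r`"
  have hmemA : ∀ x : Fin n → Bool, x ∈ A ↔ ∃ c ∈ C, hammingDist x (bits c) ≤ r := hLiff
  -- (i) the null side: `ν(A) ≤ (r+1)·3^{-r}`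
  let 𝒞 : Finset (Fin n → Bool) := ((C : Set (Fin n → ZMod 2)).toFinset).image bits
  have hA𝒞 : A = {x | ∃ c ∈ 𝒞, hammingDist x c ≤ r} := by
    ext x
    rw [hmemA]
    simp only [𝒞, Set.mem_setOf_eq, mem_image, Set.mem_toFinset, SetLike.mem_coe]
    constructor
    · rintro ⟨c, hc, h⟩
      exact ⟨bits c, ⟨c, hc, rfl⟩, h⟩
    · rintro ⟨_, ⟨c, hc, rfl⟩, h⟩
      exact ⟨c, hc, h⟩
  have hsep : ∀ c ∈ 𝒞, ∀ c' ∈ 𝒞, c ≠ c' → 4 * r < hammingDist c c' := by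
    intro c hc c' hc' hne
    obtain ⟨d, hd, rfl⟩ := mem_image.1 hc
    obtain ⟨d', hd', rfl⟩ := mem_image.1 hc'
    rw [Set.mem_toFinset, SetLike.mem_coe] at hd hd'
    have hne' : -d + d' ≠ 0 := fun h => hne (congrArg bits (neg_add_eq_zero.1 h))
    have h1 := hdist (-d + d') (C.add_mem (C.neg_mem hd) hd') hne'
    rwa [hammingDist_bits, hammingDist_eq_hammingNorm]
  have hν : ((PMF.uniformOfFintype (Fin n → Bool)).toOuterMeasure A).toReal ≤
      ((r : ℝ) + 1) * (1 / 3) ^ r := by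
    rw [hA𝒞]
    refine (toReal_uniform_near_le 𝒞 r h2r hsep).trans ?_
    rw [mul_div_assoc]
    exact mul_le_mul_of_nonneg_left (null_ratio_le_of_le hm n) (by positivity)
  have hνc : ((PMF.uniformOfFintype (Fin n → Bool)).toOuterMeasure
      {x | List.ofFn x ∉ L}).toReal =
      1 - ((PMF.uniformOfFintype (Fin n → Bool)).toOuterMeasure A).toReal := by
    have hc : {x : Fin n → Bool | List.ofFn x ∉ L} = Aᶜ := Set.ext fun _ => Iff.rfl
    rw [hc, toOuterMeasure_eq_one_sub_compl _ Aᶜ, compl_compl,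
      ENNReal.toReal_sub_of_le (le_of_le_of_eq le_self_add (toOuterMeasure_add_compl _ _))
        ENNReal.one_ne_top, ENNReal.toReal_one]
  -- (ii) the planted side: `(T_δ μ)(A) ≥ 1 - (1+δ)ⁿ/2^{r+1}`
  have hAsupp : ∀ x ∈ μ.support, ∀ z : Fin n → Bool, hammingDist z x ≤ r → z ∈ A := by
    intro x hx z hz
    obtain ⟨d, hd, rfl⟩ := (PMF.mem_support_map_iff _ _ _).1 hx
    rw [mem_support_uniformOn_iff] at hd
    exact (hmemA z).2 ⟨d, hd, hz⟩
  have hnoise := le_noiseOp_toOuterMeasure (1 / (4 * m)) μ A r hAsupp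
  have hδ0 : (0 : ℝ) ≤ 1 / (4 * m) := by positivity
  have hδ1 : (1 / (4 * m) : ℝ) ≤ 1 := by
    rw [div_le_one (by positivity)]
    have : (8 : ℝ) ≤ m := by exact_mod_cast hm
    linarith
  set b₂ : ℝ := (1 + 1 / (4 * m) : ℝ) ^ n / 2 ^ (r + 1) with hb₂
  have hb₂0 : 0 ≤ b₂ := by rw [hb₂]; positivity
  have hB : (1 + clampENNReal (1 / (4 * m) : ℝ)) ^ Fintype.card (Fin n) / 2 ^ (r + 1) =
      ENNReal.ofReal b₂ := by
    have hclamp : clampENNReal (1 / (4 * m) : ℝ) = ENNReal.ofReal (1 / (4 * m)) := by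
      rw [clampENNReal, min_eq_left hδ1]
    rw [Fintype.card_fin, hclamp, ← ENNReal.ofReal_one,
      ← ENNReal.ofReal_add (p := 1) (q := 1 / (4 * m)) zero_le_one hδ0,
      ← ENNReal.ofReal_pow (p := 1 + 1 / (4 * m)) (by positivity), hb₂,
      ENNReal.ofReal_div_of_pos (pow_pos two_pos (r + 1)), ENNReal.ofReal_pow zero_le_two,
      ENNReal.ofReal_ofNat]
  have hplanted : 1 - b₂ ≤ ((noiseOp (1 / (4 * m)) μ).toOuterMeasure A).toReal := by
    rw [hB, ← ENNReal.ofReal_one, ← ENNReal.ofReal_sub _ hb₂0] at hnoise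
    exact (ENNReal.ofReal_le_iff_le_toReal ((le_of_le_of_eq le_self_add
      (toOuterMeasure_add_compl _ _)).trans_lt ENNReal.one_lt_top).ne).1 hnoise
  have hb₂le : b₂ ≤ (2 / 3) ^ (r + 1) := noise_tail_le_of_pos hm0 n
  -- (iii) combine
  have hT1 : (0 : ℝ) ≤ ((r : ℝ) + 1) * (1 / 3) ^ r := by positivity
  have hνA0 : 0 ≤ ((PMF.uniformOfFintype (Fin n → Bool)).toOuterMeasure A).toReal :=
    ENNReal.toReal_nonneg
  show _ ≤ 1 / 2 * _ + 1 / 2 * ((noiseOp (1 / (4 * m)) μ).toOuterMeasure A).toReal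
  rw [hνc]
  linarith

/-- **Holmgren–Wein's Theorem 2 from ANY suitable code family (parameter-free interface).** Let
`m ≥ 8`, let `nᵢ → ∞` be block lengths with binary linear codes `Cᵢ ≤ 𝔽₂^{nᵢ}`, and let `L ∈ P`
be one polynomial-time test such that, for infinitely many `i`: the dual distance of `Cᵢ`
exceeds `⌊nᵢ/m⌋`, every nonzero codeword of `Cᵢ` has weight `> 4⌊nᵢ/m⌋`, and the length-`nᵢ`
slice of `L` is the radius-`⌊nᵢ/m⌋` Hamming neighbourhood of `Cᵢ` (a bounded-distance decoder's
acceptance set). Then `LowDegreeCounterexamples` holds, with `c = 1/m`, `δ = 1/(4m)`,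
`εₙ = (⌊n/m⌋+1)3^{-⌊n/m⌋} + (2/3)^{⌊n/m⌋+1}` and `μ = Unif(Cᵢ)` (`⌊nᵢ/m⌋`-wise independent by
Prop. 1). This isolates exactly what remains unformalised below the barrier fact: an explicit
family of binary linear codes with linear distance, linear dual distance and a polynomial-time
bounded-distance test at a linear radius (in print: Prop. 3, binary images of
Garcia–Stichtenoth algebraic-geometry codes over `𝔽₆₄` with Guruswami's decoder).
[cite: HolmgrenWein2021, Thm. 2 and §5.2 (arXiv pp. 6, 9; LIPIcs Thm. 7, pp. 75:4, 75:8), Prop. 3 (arXiv p. 7)] -/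
theorem LowDegreeCounterexamples.of_family {m : ℕ} (hm : 8 ≤ m) {len : ℕ → ℕ}
    (hlen : Tendsto len atTop atTop) (C : ∀ i : ℕ, Submodule (ZMod 2) (Fin (len i) → ZMod 2))
    {L : Language Bool} (hL : L ∈ P)
    (hgood : ∃ᶠ i in atTop, ((len i / m : ℕ) : ℕ∞) < dualDist (C i) ∧
      (∀ c ∈ C i, c ≠ 0 → 4 * (len i / m) < hammingNorm c) ∧
      ∀ x : Fin (len i) → Bool, List.ofFn x ∈ L ↔ ∃ c ∈ C i, hammingDist x (bits c) ≤ len i / m) :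
    LowDegreeCounterexamples := by
  have hm0 : 0 < m := lt_of_lt_of_le (by norm_num) hm
  refine ⟨1 / m, 1 / (4 * m), L,
    fun n => (((n / m : ℕ) : ℝ) + 1) * (1 / 3) ^ (n / m) + (2 / 3) ^ (n / m + 1),
    by positivity, by positivity, hL, ?_, ?_⟩
  · -- `εₙ → 0`
    have hdiv : Tendsto (fun n : ℕ => n / m) atTop atTop := Nat.tendsto_div_const_atTop hm0.ne'
    have h1 : Tendsto (fun k : ℕ => ((k : ℝ) + 1) * (1 / 3 : ℝ) ^ k) atTop (nhds 0) := by
      have ha := tendsto_self_mul_const_pow_of_lt_one (r := (1 / 3 : ℝ)) (by norm_num) (by norm_num)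
      have hb := tendsto_pow_atTop_nhds_zero_of_lt_one (r := (1 / 3 : ℝ)) (by norm_num) (by norm_num)
      have := ha.add hb
      rw [add_zero] at this
      exact this.congr fun k => by ring
    have h2 : Tendsto (fun k : ℕ => (2 / 3 : ℝ) ^ (k + 1)) atTop (nhds 0) :=
      (tendsto_pow_atTop_nhds_zero_of_lt_one (by norm_num) (by norm_num)).comp
        (tendsto_add_atTop_nat 1)
    have := (h1.comp hdiv).add (h2.comp hdiv)
    rw [add_zero] at this
    exact this
  · -- infinitely often: at every good code length `nᵢ`
    refine frequently_atTop.2 fun N => ?_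
    obtain ⟨i, ⟨hdual, hdist, hLiff⟩, hNi⟩ :=
      (hgood.and_eventually (tendsto_atTop.1 hlen N)).exists
    refine ⟨len i, hNi, (uniformOn (C i)).map bits, ?_, testSuccess_ge_of_family hm (C i) hdist hLiff⟩
    have hfloor : ⌊1 / (m : ℝ) * (len i : ℕ)⌋₊ = len i / m := by
      rw [one_div_mul_eq_div]
      exact Nat.floor_div_eq_div (len i) m
    rw [hfloor]
    exact isDWiseIndependent_map_bits (C i) hdual

/-- **Consistency of the interface.** The codes of `DecodableDualDistanceCodes` (Prop. 3) meet the
hypotheses of `LowDegreeCounterexamples.of_family` with `m = 128` and `L = bddLanguage C (1/128)`: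
`⌊n/128⌋ < ζn ≤` dual distance, `4⌊n/128⌋ ≤ 2⌊ζn/2⌋ <` every nonzero weight (`ζ ≥ 1/30`), and the
length-`nᵢ` slice of `bddLanguage C (1/128)` is the radius-`⌊nᵢ/128⌋` neighbourhood of `Cᵢ`
(`ofFn_mem_bddLanguage_iff`). Hence `of_codes` is an instance of `of_family`.
[cite: HolmgrenWein2021, Prop. 3 (arXiv p. 7) and §5.2 (arXiv p. 9)] -/
theorem LowDegreeCounterexamples.of_codes_via_family (h : DecodableDualDistanceCodes) :
    LowDegreeCounterexamples := by
  obtain ⟨ζ, hζ, C, hdual, hdist, hP⟩ := h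
  refine LowDegreeCounterexamples.of_family (m := 128) (by norm_num) tendsto_hwLength C
    (hP (1 / 128) (by norm_num) (by push_cast; linarith))
    (Frequently.of_forall fun i => ⟨?_, ?_, ?_⟩)
  · -- dual distance: `⌊n/128⌋ ≤ n/128 < ζ n ≤ d⊥`
    refine natCast_lt_dualDist_of_le_weight (C i) (hdual i) ?_
    have hn : (0 : ℝ) < hwLength i := by exact_mod_cast lt_of_lt_of_le (by norm_num) (le_hwLength i)
    have h1 : ((hwLength i / 128 : ℕ) : ℝ) ≤ (hwLength i : ℝ) / 128 := Nat.cast_div_le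
    have h2 := mul_le_mul_of_nonneg_right hζ hn.le
    linarith
  · -- weights: `4⌊n/128⌋ ≤ 2⌊ζn/2⌋ < ‖c‖`
    intro c hc hc0
    have h4r : 4 * (hwLength i / 128) ≤ 2 * ⌊ζ * hwLength i / 2⌋₊ := by
      suffices h : 2 * (hwLength i / 128) ≤ ⌊ζ * hwLength i / 2⌋₊ by omega
      refine Nat.le_floor ?_
      have h1 : ((hwLength i / 128 : ℕ) : ℝ) ≤ hwLength i / 128 := Nat.cast_div_le
      have h2 : (0 : ℝ) ≤ hwLength i := Nat.cast_nonneg _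
      have h3 := mul_le_mul_of_nonneg_right hζ h2
      push_cast
      linarith
    exact lt_of_le_of_lt h4r (hdist i c hc hc0)
  · -- the slice of the bounded-distance language
    intro x
    rw [ofFn_mem_bddLanguage_iff]
    refine exists_congr fun c => and_congr_right fun _ => ?_
    rw [Nat.le_div_iff_mul_le (by norm_num), one_div_mul_eq_div,
      le_div_iff₀ (by norm_num : (0 : ℚ) < 128)]
    norm_cast

end Literature.Barriers.PneNP

end
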